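import Literature.Combinatorics.Optimization.PerfectMatchingPolytopeAdjacency
import Mathlib.GroupTheory.Perm.Fin
import HarnessLib

/-!
# The perfect matching polytope of `K_n` has diameter at most two: any two perfect matchings are
# equal, adjacent, or have a common neighbour (PROVED)

Sources and status of the printed statement.
* A. Schrijver, *Combinatorial Optimization — Polyhedra and Efficiency* [Schrijver2003], Vol. A
  §25.5a "Adjacency and diameter of the matching polytope" (p. 444; the section title and page are
  read from the held table of contents of `book:schrijvernd-combinatorial-optimization` (chunk p0084);
  the text of Vol. A is NOT held — cited by section title only), where the adjacency criterion of
  Chvátal 1975 (the tree's `Chvatal1975_cor63_perfectMatching`, `PerfectMatchingPolytopeAdjacency.lean`)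
  and the diameter of the (perfect) matching polytope are treated; the diameter-two phenomenon for this
  family of polyhedra goes back to M. W. Padberg, M. R. Rao, *The travelling salesman problem and a class
  of polyhedra of diameter two*, Math. Programming 7 (1974) 32–45 (paywalled, acquisition request
  acq-14672; its TSP form is quoted in the held MAA volume *Geometry at Work*, galaxy
  panama:449244989227018, Thm. 4.1: "Δ(T_n) = 2 for all n ≥ 6"). Because neither printed proof is held,
  THE THEOREM BELOW IS STATED AND PROVED INDEPENDENTLY, in the vocabulary and currency of
  `PerfectMatchingPolytopeAdjacency.lean` (Chvátal's neighbour relation `IsNeighbor` = an integer objective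
  maximised over the perfect matchings exactly at the two of them; equivalently an exposed segment of
  `conv{χ^M}`, `isNeighbor_iff_isExposed_segment`); the attribution is by section title.
* V. Chvátal, *On certain polytopes associated with graphs*, JCTB 18 (1975) [Chvatal1975], §6 Cor. 6.3
  (p. 150) — the adjacency criterion used throughout (held, see the sister file).

THE THEOREM (`exists_common_neighbor`, `pmPolytope_diameter_le_two`). Let `M ≠ M''` be perfect matchings of
`K_n` whose symmetric difference is NOT one circuit (so `M △ M''` is a union of `r ≥ 2` alternating
circuits `C_1, …, C_r`). Pick one vertex `v_i` on each `C_i` and let `e_i = {v_i, M''(v_i)}` be the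
`M''`-edge at `v_i`. Define the perfect matching `M'` (`bridgePM`) to agree with `M''` everywhere except
that the `r` edges `e_i` are replaced by the `r` "bridges" `g_i = {M''(v_i), v_{i+1}}` (indices cyclic).
Then `M △ M'` is ONE circuit (all of `C_1 ∪ … ∪ C_r` minus the `e_i`, plus the bridges: a Hamiltonian
circuit of `V(M △ M'')`) and `M'' △ M'` is ONE circuit (the `2r`-gon `e_1 g_1 e_2 g_2 … e_r g_r`), so `M'`
is adjacent to both: **any two vertices of `P_PM(K_n)` are joined by an edge path of length `≤ 2`**
(`pmPolytope_diameter_le_two`: `M = M'' ∨ IsNeighbor M M'' ∨ ∃ M', IsNeighbor M M' ∧ IsNeighbor M'' M'`;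
geometric form `pmPolytope_diameter_le_two_isExposed`). Complements: (`isNeighbor_of_lt_eight`) two
circuits need `8` vertices, so for `n < 8` (i.e. `K_2, K_4, K_6`) any two distinct perfect matchings are
adjacent — the 1-skeleton is complete; (`exists_not_isNeighbor`, `pmPolytope_diameter_eq_two`) for
`n ≥ 8` every perfect matching `M` has a NON-neighbour — the conjugate `π M π` by a double transposition
`π = (a₁ a₂)(a₃ a₄)` with `a_i, M(a_i)` eight distinct vertices (`twoSquaresPM`: `M △ N` = two disjoint
alternating 4-cycles) — so the diameter of `P_PM(K_n)` is EXACTLY `2` for every even `n ≥ 8`.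

Method (all proofs are the switching/closure calculus of the sister file, no case analysis on pictures):
§1 the alternating walk `alt M N v k` (`v, M(v), N(M(v)), …`), its parity lemma (equal values occur only
at indices of equal parity — fixed-point-freeness), first return (pigeonhole) and periodicity, and
COVERAGE: the walk from `v` visits exactly the connected component of `v` in the graph of `M △ N`
(`exists_alt_eq_of_reachable`, via `IsSwitchClosed.mem_of_reachable`); §2 the components of `M △ N`
meeting its vertex set (`cycComps`, Mathlib `SimpleGraph.ConnectedComponent`), representatives `rep i`,
`2 ≤ #cycComps` iff not connected; §3 the bridge matching `bridgeFun`/`bridgePM` (the cyclic order on the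
components is Mathlib's `finRotate`); §4 closure lemmas: a vertex set closed under `M` and `M'` that meets
`V(M △ M'')` contains a representative or its `M''`-partner, then a whole component, then (around the
cycle of bridges, `Equiv.Perm.IsCycle.exists_pow_eq`) everything — i.e. `SwitchIrreducible M M'`; and a set
closed under `M''` and `M'` meeting the special vertices contains all of them — `SwitchIrreducible M'' M'`;
§5 assembly via `isNeighbor_iff_switchIrreducible`; §6 the small cases (`exists_four_reachable`,
`eight_le_of_not_symmDiffConnected`); §7 the non-adjacent pair for `n ≥ 8` (`dswap`, `twoSquaresFun`,
`not_isNeighbor_twoSquaresPM` — the closed set `{a₁, M(a₁), a₂, M(a₂)}` splits `V(M △ N)` —,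
`exists_four_spread` by greedy choice).

Honest placement. Label: catalogue / instrument — the diameter of the 1-skeleton of the cell's polytope;
no bearing on `rank_psd` or the crux `stmt-PneNP-19878`; no P-vs-NP content. NOT here: the matching
(non-perfect) polytope and the perfect matching polytopes `P_PM(G)` of non-complete graphs (whose
diameters are hard to compute, Wulf 2025 / Nöbel–Steiner 2025), Padberg–Rao's TSP/assignment statements.

presearch (2026-08-29). Tree: nothing on diameters of 0/1-polytope skeletons (`lean search`
"diameter.*polytope|skeleton"); corpus/galaxy: Padberg–Rao 1974 paywalled (acq-14672), Rispoli 1992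
(acq-14675), Schrijver Vol. A §25.5a title only, *Geometry at Work* Thm 4.1 (TSP form) held via galaxy;
Wulf FOCS 2025 (arXiv:2502.16398) and Nöbel–Steiner 2025 study diameters of P_PM(G) for general
(bipartite) G, where computing the diameter is hard — for `K_n` it is the constant `2`.
-/

noncomputable section

open Finset
open scoped symmDiff

namespace Literature.Combinatorics.Optimization

open Literature.Barriers.PneNP
open PerfectMatchingPolytope (IsPM)

namespace PMPolytopeDim

variable {n : ℕ}

/-! ### §1 The alternating walk of two perfect matchings from a vertex -/

/-- The alternating walk `v, M(v), N(M(v)), M(N(M(v))), …`: step `k → k+1` applies `M` for even `k` and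
`N` for odd `k`. [cite: Schrijver2003, Vol. A §25.5a (p. 444)] -/
def alt (M N : PMatch n) (v : Fin n) : ℕ → Fin n
  | 0 => v
  | k + 1 => if k % 2 = 0 then pmPartner M (alt M N v k) else pmPartner N (alt M N v k)

/-- `alt 0 = v`. [cite: Schrijver2003, Vol. A §25.5a (p. 444)] -/
theorem alt_zero (M N : PMatch n) (v : Fin n) : alt M N v 0 = v := rfl

/-- The step of the walk. [cite: Schrijver2003, Vol. A §25.5a (p. 444)] -/
theorem alt_succ (M N : PMatch n) (v : Fin n) (k : ℕ) :
    alt M N v (k + 1) = if k % 2 = 0 then pmPartner M (alt M N v k) else pmPartner N (alt M N v k) := rfl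

/-- The step map at parity `b`: `M` for even, `N` for odd indices. [cite: Schrijver2003, Vol. A §25.5a (p. 444)] -/
def stepFun (M N : PMatch n) (k : ℕ) : Fin n → Fin n :=
  fun w => if k % 2 = 0 then pmPartner M w else pmPartner N w

/-- `alt (k+1) = stepFun k (alt k)`. [cite: Schrijver2003, Vol. A §25.5a (p. 444)] -/
theorem alt_succ_eq_stepFun (M N : PMatch n) (v : Fin n) (k : ℕ) :
    alt M N v (k + 1) = stepFun M N k (alt M N v k) := by
  rw [alt_succ]; rfl

/-- Each step map is a fixed-point-free involution. [cite: Schrijver2003, Vol. A §25.5a (p. 444)] -/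
theorem stepFun_stepFun (M N : PMatch n) (k : ℕ) (w : Fin n) : stepFun M N k (stepFun M N k w) = w := by
  unfold stepFun; split_ifs <;> exact pmPartner_pmPartner _ _

/-- No step fixes a vertex. [cite: Schrijver2003, Vol. A §25.5a (p. 444)] -/
theorem stepFun_ne (M N : PMatch n) (k : ℕ) (w : Fin n) : stepFun M N k w ≠ w := by
  unfold stepFun; split_ifs <;> exact pmPartner_ne _ _

/-- Step maps depend only on the parity of the index. [cite: Schrijver2003, Vol. A §25.5a (p. 444)] -/
theorem stepFun_eq_of_mod_eq (M N : PMatch n) {i j : ℕ} (h : i % 2 = j % 2) : stepFun M N i = stepFun M N j := by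
  unfold stepFun; rw [h]

/-- **Parity lemma**: the walk never returns to a vertex after an odd number of steps.
[cite: Schrijver2003, Vol. A §25.5a (p. 444)] -/
theorem alt_ne_alt_add_of_odd (M N : PMatch n) (v : Fin n) :
    ∀ d : ℕ, d % 2 = 1 → ∀ i : ℕ, alt M N v i ≠ alt M N v (i + d) := by
  intro d
  induction d using Nat.strong_induction_on with
  | _ d ih =>
    intro hd i heq
    rcases Nat.lt_or_ge d 2 with hlt | hge
    · -- `d = 1`: one step is a fixed-point-free map
      have hd1 : d = 1 := by omega
      subst hd1
      rw [alt_succ_eq_stepFun] at heq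
      exact stepFun_ne M N i _ heq.symm
    · -- `d ≥ 3` odd: the steps at `i` and at `i + d - 1` have the same type
      obtain ⟨d', rfl⟩ : ∃ d', d = d' + 2 := ⟨d - 2, by omega⟩
      have hpar : i % 2 = (i + d' + 1) % 2 := by omega
      have h1 : alt M N v (i + 1) = stepFun M N i (alt M N v i) := alt_succ_eq_stepFun M N v i
      have h2 : alt M N v (i + (d' + 2)) = stepFun M N (i + d' + 1) (alt M N v (i + d' + 1)) := by
        rw [show i + (d' + 2) = (i + d' + 1) + 1 by ring]; exact alt_succ_eq_stepFun M N v _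
      have h3 : alt M N v (i + d' + 1) = stepFun M N i (alt M N v i) := by
        rw [stepFun_eq_of_mod_eq M N hpar, heq, h2, stepFun_stepFun]
      have h4 : alt M N v (i + 1) = alt M N v ((i + 1) + d') := by
        rw [h1, ← h3]; ring_nf
      exact ih d' (by omega) (by omega) (i + 1) h4

/-- Equal values of the walk occur at indices of equal parity. [cite: Schrijver2003, Vol. A §25.5a (p. 444)] -/
theorem mod_two_eq_of_alt_eq (M N : PMatch n) (v : Fin n) {i j : ℕ} (h : alt M N v i = alt M N v j) :
    i % 2 = j % 2 := by
  by_contra hne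
  rcases Nat.lt_or_ge i j with hij | hij
  · exact alt_ne_alt_add_of_odd M N v (j - i) (by omega) i (by rw [Nat.add_sub_cancel' hij.le]; exact h)
  · exact alt_ne_alt_add_of_odd M N v (i - j) (by omega) j (by rw [Nat.add_sub_cancel' hij]; exact h.symm)

/-- Backward determinism: equal values at indices of equal parity propagate one step back.
[cite: Schrijver2003, Vol. A §25.5a (p. 444)] -/
theorem alt_eq_of_alt_succ_eq (M N : PMatch n) (v : Fin n) {i j : ℕ} (hpar : i % 2 = j % 2)
    (h : alt M N v (i + 1) = alt M N v (j + 1)) : alt M N v i = alt M N v j := by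
  rw [alt_succ_eq_stepFun, alt_succ_eq_stepFun, stepFun_eq_of_mod_eq M N hpar] at h
  have := congrArg (stepFun M N j) h
  rwa [stepFun_stepFun, stepFun_stepFun] at this

/-- A coincidence `alt i = alt (i + d)` shifts back to `alt 0 = alt d`. [cite: Schrijver2003, Vol. A §25.5a (p. 444)] -/
theorem alt_eq_alt_of_shift (M N : PMatch n) (v : Fin n) :
    ∀ i d : ℕ, alt M N v i = alt M N v (i + d) → alt M N v 0 = alt M N v d := by
  intro i
  induction i with
  | zero => intro d h; simpa using h
  | succ i ih =>
    intro d h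
    have hpar : i % 2 = (i + d) % 2 := by
      have := mod_two_eq_of_alt_eq M N v h; omega
    refine ih d (alt_eq_of_alt_succ_eq M N v hpar ?_)
    rw [show i + d + 1 = i + 1 + d by ring]; exact h

/-- **First return**: the walk comes back to `v` after a positive even number `p ≤ n` of steps
(pigeonhole on the first `n + 1` values, then the parity lemma and backward determinism).
[cite: Schrijver2003, Vol. A §25.5a (p. 444)] -/
theorem exists_alt_return (M N : PMatch n) (v : Fin n) :
    ∃ p : ℕ, 0 < p ∧ p % 2 = 0 ∧ alt M N v p = v := by
  obtain ⟨x, y, hxy, hf⟩ := Fintype.exists_ne_map_eq_of_card_lt (fun i : Fin (n + 1) => alt M N v i)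
    (by simp)
  -- order the two indices
  have key : ∀ a b : ℕ, a < b → alt M N v a = alt M N v b → ∃ p, 0 < p ∧ p % 2 = 0 ∧ alt M N v p = v := by
    intro a b hab h
    refine ⟨b - a, by omega, ?_, ?_⟩
    · have := mod_two_eq_of_alt_eq M N v h; omega
    · have h' : alt M N v a = alt M N v (a + (b - a)) := by rw [Nat.add_sub_cancel' hab.le]; exact h
      exact (alt_eq_alt_of_shift M N v a (b - a) h').symm
  rcases Nat.lt_or_gt_of_ne (fun h => hxy (Fin.ext h)) with h | h
  · exact key _ _ h hf
  · exact key _ _ h hf.symm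

/-- Periodicity: after a return the walk repeats. [cite: Schrijver2003, Vol. A §25.5a (p. 444)] -/
theorem alt_add_period (M N : PMatch n) (v : Fin n) {p : ℕ} (hp2 : p % 2 = 0) (hpv : alt M N v p = v) :
    ∀ k, alt M N v (k + p) = alt M N v k := by
  intro k
  induction k with
  | zero => rw [Nat.zero_add, alt_zero]; exact hpv
  | succ k ih =>
    rw [show k + 1 + p = (k + p) + 1 by ring, alt_succ_eq_stepFun, alt_succ_eq_stepFun, ih,
      stepFun_eq_of_mod_eq M N (show (k + p) % 2 = k % 2 by omega)]

/-- The last vertex before the return is `N(v)`: the walk enters `v` through its `N`-edge.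
[cite: Schrijver2003, Vol. A §25.5a (p. 444)] -/
theorem alt_pred_period (M N : PMatch n) (v : Fin n) {p : ℕ} (hp : 0 < p) (hp2 : p % 2 = 0)
    (hpv : alt M N v p = v) : alt M N v (p - 1) = pmPartner N v := by
  obtain ⟨q, rfl⟩ : ∃ q, p = q + 1 := ⟨p - 1, by omega⟩
  rw [Nat.add_sub_cancel]
  rw [alt_succ, if_neg (by omega)] at hpv
  have := congrArg (pmPartner N) hpv
  rwa [pmPartner_pmPartner] at this

/-- The walk stays inside the vertex set of `M △ N` when it starts there. [cite: Schrijver2003, Vol. A §25.5a (p. 444)] -/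
theorem alt_mem_diffVerts {M N : PMatch n} {v : Fin n} (hv : v ∈ diffVerts M N) :
    ∀ k, alt M N v k ∈ diffVerts M N := by
  intro k
  induction k with
  | zero => exact hv
  | succ k ih =>
    rw [alt_succ]
    split_ifs
    · exact pmPartner_mem_diffVerts ih
    · exact pmPartner_mem_diffVerts' ih

/-- Every vertex of the walk is reachable from `v` in the graph of `M △ N` (for `v` on `M △ N`).
[cite: Schrijver2003, Vol. A §25.5a (p. 444)] -/
theorem reachable_alt {M N : PMatch n} {v : Fin n} (hv : v ∈ diffVerts M N) :
    ∀ k, (symmDiffGraph M N).Reachable v (alt M N v k) := by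
  intro k
  induction k with
  | zero => exact SimpleGraph.Reachable.refl v
  | succ k ih =>
    refine ih.trans (SimpleGraph.Adj.reachable (symmDiffGraph_adj.2 ⟨alt_mem_diffVerts hv k, ?_⟩))
    rw [alt_succ]
    split_ifs
    · exact Or.inl rfl
    · exact Or.inr rfl

/-- The (finite) trace of the walk over one period. [cite: Schrijver2003, Vol. A §25.5a (p. 444)] -/
def altTrace (M N : PMatch n) (v : Fin n) (p : ℕ) : Finset (Fin n) := (Finset.range p).image (alt M N v)

/-- The trace over a period is closed under both partner maps. [cite: Schrijver2003, Vol. A §25.5a (p. 444)] -/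
theorem isSwitchClosed_altTrace (M N : PMatch n) (v : Fin n) {p : ℕ} (hp : 0 < p) (hp2 : p % 2 = 0)
    (hpv : alt M N v p = v) : IsSwitchClosed M N (altTrace M N v p) := by
  intro w hw
  simp only [altTrace, mem_image, mem_range] at hw ⊢
  obtain ⟨k, hk, rfl⟩ := hw
  by_cases hk2 : k % 2 = 0
  · refine ⟨⟨k + 1, ?_, by rw [alt_succ, if_pos hk2]⟩, ?_⟩
    · -- `k + 1 = p` would make `p` odd
      rcases Nat.lt_or_ge (k + 1) p with h | h
      · exact h
      · exfalso; omega
    · rcases Nat.eq_zero_or_pos k with rfl | hk0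
      · exact ⟨p - 1, by omega, by rw [alt_pred_period M N v hp hp2 hpv]; rfl⟩
      · refine ⟨k - 1, by omega, ?_⟩
        have h1 : alt M N v k = pmPartner N (alt M N v (k - 1)) := by
          conv_lhs => rw [show k = (k - 1) + 1 by omega, alt_succ, if_neg (by omega)]
        rw [h1, pmPartner_pmPartner]
  · refine ⟨⟨k - 1, by omega, ?_⟩, ?_⟩
    · have h1 : alt M N v k = pmPartner M (alt M N v (k - 1)) := by
        conv_lhs => rw [show k = (k - 1) + 1 by omega, alt_succ, if_pos (by omega)]
      rw [h1, pmPartner_pmPartner]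
    · rcases Nat.lt_or_ge (k + 1) p with h | h
      · exact ⟨k + 1, h, by rw [alt_succ, if_neg hk2]⟩
      · have hk1 : k + 1 = p := by omega
        refine ⟨0, hp, ?_⟩
        have h1 : alt M N v (k + 1) = pmPartner N (alt M N v k) := by rw [alt_succ, if_neg hk2]
        rw [alt_zero, ← h1, hk1, hpv]

/-- **Coverage**: the alternating walk from `v` visits every vertex of the connected component of `v`
in the graph of `M △ N` — the component is ONE alternating circuit traversed by the walk.
[cite: Schrijver2003, Vol. A §25.5a (p. 444)] -/
theorem exists_alt_eq_of_reachable {M N : PMatch n} {v w : Fin n}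
    (h : (symmDiffGraph M N).Reachable v w) : ∃ k, alt M N v k = w := by
  obtain ⟨p, hp, hp2, hpv⟩ := exists_alt_return M N v
  have hv : v ∈ altTrace M N v p := by
    simp only [altTrace, mem_image, mem_range]; exact ⟨0, hp, rfl⟩
  have hw := (isSwitchClosed_altTrace M N v hp hp2 hpv).mem_of_reachable hv h
  simp only [altTrace, mem_image, mem_range] at hw
  obtain ⟨k, -, hk⟩ := hw
  exact ⟨k, hk⟩

/-! ### §2 The alternating circuits of `M △ N` as connected components, and representatives -/

open Classical in
/-- The connected components of the graph of `M △ N` that meet its vertex set — the alternating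
circuits `C_1, …, C_r` of `M △ N`. [cite: Schrijver2003, Vol. A §25.5a (p. 444)] -/
def cycComps (M N : PMatch n) : Finset (symmDiffGraph M N).ConnectedComponent :=
  (diffVerts M N).image (symmDiffGraph M N).connectedComponentMk

/-- Membership in `cycComps`. [cite: Schrijver2003, Vol. A §25.5a (p. 444)] -/
theorem mem_cycComps {M N : PMatch n} {c : (symmDiffGraph M N).ConnectedComponent} :
    c ∈ cycComps M N ↔ ∃ v ∈ diffVerts M N, (symmDiffGraph M N).connectedComponentMk v = c := by
  classical
  simp [cycComps]

/-- The number `r` of alternating circuits of `M △ N`. [cite: Schrijver2003, Vol. A §25.5a (p. 444)] -/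
def numCycles (M N : PMatch n) : ℕ := (cycComps M N).card

/-- A representative vertex `v_i` on the `i`-th circuit. [cite: Schrijver2003, Vol. A §25.5a (p. 444)] -/
def rep (M N : PMatch n) (i : Fin (numCycles M N)) : Fin n :=
  (mem_cycComps.1 ((cycComps M N).equivFin.symm i).2).choose

/-- `v_i` lies on `M △ N`. [cite: Schrijver2003, Vol. A §25.5a (p. 444)] -/
theorem rep_mem (M N : PMatch n) (i : Fin (numCycles M N)) : rep M N i ∈ diffVerts M N :=
  (mem_cycComps.1 ((cycComps M N).equivFin.symm i).2).choose_spec.1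

/-- The component of `v_i` is the `i`-th one. [cite: Schrijver2003, Vol. A §25.5a (p. 444)] -/
theorem mk_rep (M N : PMatch n) (i : Fin (numCycles M N)) :
    (symmDiffGraph M N).connectedComponentMk (rep M N i) = ((cycComps M N).equivFin.symm i).1 :=
  (mem_cycComps.1 ((cycComps M N).equivFin.symm i).2).choose_spec.2

/-- Distinct representatives lie on distinct circuits. [cite: Schrijver2003, Vol. A §25.5a (p. 444)] -/
theorem eq_of_reachable_rep {M N : PMatch n} {i j : Fin (numCycles M N)}
    (h : (symmDiffGraph M N).Reachable (rep M N i) (rep M N j)) : i = j := by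
  have h1 := SimpleGraph.ConnectedComponent.sound h
  rw [mk_rep, mk_rep] at h1
  exact (cycComps M N).equivFin.symm.injective (Subtype.ext h1)

/-- `rep` is injective. [cite: Schrijver2003, Vol. A §25.5a (p. 444)] -/
theorem rep_injective (M N : PMatch n) : Function.Injective (rep M N) :=
  fun _ _ h => eq_of_reachable_rep (h ▸ SimpleGraph.Reachable.refl _)

/-- Every vertex of `M △ N` is reachable from the representative of its circuit.
[cite: Schrijver2003, Vol. A §25.5a (p. 444)] -/
theorem exists_rep_reachable {M N : PMatch n} {w : Fin n} (hw : w ∈ diffVerts M N) :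
    ∃ i, (symmDiffGraph M N).Reachable (rep M N i) w := by
  have hc : (symmDiffGraph M N).connectedComponentMk w ∈ cycComps M N := mem_cycComps.2 ⟨w, hw, rfl⟩
  refine ⟨(cycComps M N).equivFin ⟨_, hc⟩, ?_⟩
  rw [← SimpleGraph.ConnectedComponent.eq, mk_rep, Equiv.symm_apply_apply]

/-- A representative is never the `N`-partner of a representative (its own: no fixed points; another's:
different circuits). [cite: Schrijver2003, Vol. A §25.5a (p. 444)] -/
theorem rep_ne_partner_rep (M N : PMatch n) (i j : Fin (numCycles M N)) :
    rep M N i ≠ pmPartner N (rep M N j) := by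
  intro h
  have hreach : (symmDiffGraph M N).Reachable (rep M N j) (rep M N i) := by
    rw [h]; exact (symmDiffGraph_adj.2 ⟨rep_mem M N j, Or.inr rfl⟩).reachable
  have hij := eq_of_reachable_rep hreach
  subst hij
  exact pmPartner_ne N _ h.symm

/-- `M △ N` is disconnected (as a graph without isolated vertices) iff it has at least two circuits.
[cite: Schrijver2003, Vol. A §25.5a (p. 444)] -/
theorem two_le_numCycles {M N : PMatch n} (hne : M ≠ N) (h : ¬SymmDiffConnected M N) :
    2 ≤ numCycles M N := by
  classical
  unfold SymmDiffConnected at h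
  push Not at h
  obtain ⟨u, hu, v, hv, huv⟩ := h hne
  rw [support_symmDiffGraph, Finset.mem_coe] at hu hv
  have hlt : 1 < (cycComps M N).card := by
    rw [Finset.one_lt_card_iff]
    refine ⟨_, _, mem_cycComps.2 ⟨u, hu, rfl⟩, mem_cycComps.2 ⟨v, hv, rfl⟩, ?_⟩
    rwa [Ne, SimpleGraph.ConnectedComponent.eq]
  exact hlt

/-- Conversely, with at least two circuits `M △ N` is not connected. [cite: Schrijver2003, Vol. A §25.5a (p. 444)] -/
theorem not_symmDiffConnected_of_two_le {M N : PMatch n} (h : 2 ≤ numCycles M N) :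
    ¬SymmDiffConnected M N := by
  rintro ⟨-, hconn⟩
  have h01 : (⟨0, by omega⟩ : Fin (numCycles M N)) ≠ ⟨1, by omega⟩ := by simp
  refine h01 (eq_of_reachable_rep (hconn _ ?_ _ ?_)) <;>
    · rw [support_symmDiffGraph, Finset.mem_coe]; exact rep_mem M N _

/-! ### §3 The bridge matching `M'` -/

/-- The cyclic successor on the circuits (Mathlib's `finRotate`). [cite: Schrijver2003, Vol. A §25.5a (p. 444)] -/
abbrev rot (M N : PMatch n) : Equiv.Perm (Fin (numCycles M N)) := finRotate (numCycles M N)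

/-- `finRotate r` moves every index once `r ≥ 2`. [folklore] -/
private theorem finRotate_ne_self_of_two_le {r : ℕ} (hr : 2 ≤ r) (i : Fin r) : finRotate r i ≠ i := by
  obtain ⟨m, rfl⟩ : ∃ m, r = m + 2 := ⟨r - 2, by omega⟩
  exact Equiv.Perm.mem_support.1 (by rw [support_finRotate]; exact mem_univ i)

/-- `finRotate r` is transitive once `r ≥ 2`. [folklore] -/
private theorem exists_finRotate_pow_eq {r : ℕ} (hr : 2 ≤ r) (i j : Fin r) :
    ∃ k : ℕ, ((finRotate r) ^ k) i = j := by
  by_cases hij : i = j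
  · exact ⟨0, by simp [hij]⟩
  obtain ⟨m, rfl⟩ : ∃ m, r = m + 2 := ⟨r - 2, by omega⟩
  exact isCycle_finRotate.exists_pow_eq (finRotate_ne_self_of_two_le hr i)
    (finRotate_ne_self_of_two_le hr j)

/-- With at least two circuits the cyclic successor moves every index. [cite: Schrijver2003, Vol. A §25.5a (p. 444)] -/
theorem rot_ne_self {M N : PMatch n} (h : 2 ≤ numCycles M N) (i : Fin (numCycles M N)) : rot M N i ≠ i :=
  finRotate_ne_self_of_two_le h i

/-- With at least two circuits the predecessor moves every index. [cite: Schrijver2003, Vol. A §25.5a (p. 444)] -/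
theorem rot_symm_ne_self {M N : PMatch n} (h : 2 ≤ numCycles M N) (i : Fin (numCycles M N)) :
    (rot M N).symm i ≠ i := by
  intro heq
  have := congrArg (rot M N) heq
  rw [Equiv.apply_symm_apply] at this
  exact rot_ne_self h i this.symm

/-- The cyclic successor is transitive: every index is a power image of every other.
[cite: Schrijver2003, Vol. A §25.5a (p. 444)] -/
theorem exists_rot_pow_eq {M N : PMatch n} (h : 2 ≤ numCycles M N) (i j : Fin (numCycles M N)) :
    ∃ k : ℕ, ((rot M N) ^ k) i = j :=
  exists_finRotate_pow_eq h i j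

open Classical in
/-- The partner map of the **bridge matching** `M'`: it is `N` except that the `N`-edges
`e_i = {v_i, N(v_i)}` at the representatives are replaced by the bridges `g_i = {N(v_i), v_{i+1}}`.
[cite: Schrijver2003, Vol. A §25.5a (p. 444)] -/
def bridgeFun (M N : PMatch n) : Fin n → Fin n := fun v =>
  if h : ∃ i, v = pmPartner N (rep M N i) then rep M N (rot M N h.choose)
  else if h' : ∃ i, v = rep M N i then pmPartner N (rep M N ((rot M N).symm h'.choose))
  else pmPartner N v

/-- `M'(N(v_i)) = v_{i+1}`. [cite: Schrijver2003, Vol. A §25.5a (p. 444)] -/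
theorem bridgeFun_partner_rep (M N : PMatch n) (i : Fin (numCycles M N)) :
    bridgeFun M N (pmPartner N (rep M N i)) = rep M N (rot M N i) := by
  classical
  have h : ∃ j, pmPartner N (rep M N i) = pmPartner N (rep M N j) := ⟨i, rfl⟩
  unfold bridgeFun
  rw [dif_pos h]
  have hj : h.choose = i := by
    have := h.choose_spec
    have h2 := congrArg (pmPartner N) this
    rw [pmPartner_pmPartner, pmPartner_pmPartner] at h2
    exact (rep_injective M N h2).symm
  rw [hj]

/-- `M'(v_i) = N(v_{i−1})`. [cite: Schrijver2003, Vol. A §25.5a (p. 444)] -/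
theorem bridgeFun_rep (M N : PMatch n) (i : Fin (numCycles M N)) :
    bridgeFun M N (rep M N i) = pmPartner N (rep M N ((rot M N).symm i)) := by
  classical
  have h1 : ¬∃ j, rep M N i = pmPartner N (rep M N j) := fun ⟨j, hj⟩ => rep_ne_partner_rep M N i j hj
  have h2 : ∃ j, rep M N i = rep M N j := ⟨i, rfl⟩
  unfold bridgeFun
  rw [dif_neg h1, dif_pos h2]
  have hj : h2.choose = i := (rep_injective M N h2.choose_spec).symm
  rw [hj]

/-- Off the `2r` special vertices `M'` agrees with `N`. [cite: Schrijver2003, Vol. A §25.5a (p. 444)] -/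
theorem bridgeFun_of_not_special (M N : PMatch n) {v : Fin n} (h1 : ∀ i, v ≠ pmPartner N (rep M N i))
    (h2 : ∀ i, v ≠ rep M N i) : bridgeFun M N v = pmPartner N v := by
  classical
  unfold bridgeFun
  rw [dif_neg (fun ⟨i, hi⟩ => h1 i hi), dif_neg (fun ⟨i, hi⟩ => h2 i hi)]

/-- The bridge map is a fixed-point-free involution (for `r ≤ 1` circuits it is just `N`).
[cite: Schrijver2003, Vol. A §25.5a (p. 444)] -/
theorem isPM_bridgeFun (M N : PMatch n) : IsPM (bridgeFun M N) := by
  intro v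
  by_cases h1 : ∃ i, v = pmPartner N (rep M N i)
  · obtain ⟨i, rfl⟩ := h1
    rw [bridgeFun_partner_rep]
    refine ⟨rep_ne_partner_rep M N _ _, ?_⟩
    rw [bridgeFun_rep, Equiv.symm_apply_apply]
  by_cases h2 : ∃ i, v = rep M N i
  · obtain ⟨i, rfl⟩ := h2
    rw [bridgeFun_rep]
    refine ⟨fun h' => rep_ne_partner_rep M N _ _ h'.symm, ?_⟩
    rw [bridgeFun_partner_rep, Equiv.apply_symm_apply]
  · push Not at h1 h2
    rw [bridgeFun_of_not_special M N h1 h2]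
    refine ⟨pmPartner_ne N v, ?_⟩
    rw [bridgeFun_of_not_special M N, pmPartner_pmPartner]
    · intro i hi
      have := congrArg (pmPartner N) hi
      rw [pmPartner_pmPartner, pmPartner_pmPartner] at this
      exact h2 i this
    · intro i hi
      exact h1 i (by rw [← hi, pmPartner_pmPartner])

/-- **The bridge matching** `M'` — the common neighbour of `M` and `N`. [cite: Schrijver2003, Vol. A §25.5a (p. 444)] -/
def bridgePM (M N : PMatch n) : PMatch n := pmOfFun (bridgeFun M N) (isPM_bridgeFun M N)

/-- Its partner map is `bridgeFun`. [cite: Schrijver2003, Vol. A §25.5a (p. 444)] -/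
theorem pmPartner_bridgePM (M N : PMatch n) : pmPartner (bridgePM M N) = bridgeFun M N :=
  pmPartner_pmOfFun _

/-- Off `V(M △ N)` the three matchings `M, N, M'` agree. [cite: Schrijver2003, Vol. A §25.5a (p. 444)] -/
theorem bridgeFun_of_not_mem_diffVerts (M N : PMatch n) {v : Fin n} (hv : v ∉ diffVerts M N) :
    bridgeFun M N v = pmPartner N v := by
  refine bridgeFun_of_not_special M N (fun i hi => hv ?_) (fun i hi => hv ?_)
  · rw [hi]; exact pmPartner_mem_diffVerts' (rep_mem M N i)
  · rw [hi]; exact rep_mem M N i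

/-- `V(M △ M') ⊆ V(M △ N)`. [cite: Schrijver2003, Vol. A §25.5a (p. 444)] -/
theorem diffVerts_bridgePM_left_subset (M N : PMatch n) :
    diffVerts M (bridgePM M N) ⊆ diffVerts M N := by
  intro v hv
  rw [mem_diffVerts, pmPartner_bridgePM] at hv
  by_contra hvD
  rw [bridgeFun_of_not_mem_diffVerts M N hvD] at hv
  exact hv (pmPartner_eq_of_not_mem_diffVerts hvD)

/-- `V(N △ M')` consists of special vertices only: `v ∈ V(N △ M')` implies `v = v_i` or `v = N(v_i)`.
[cite: Schrijver2003, Vol. A §25.5a (p. 444)] -/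
theorem special_of_mem_diffVerts_bridgePM_right {M N : PMatch n} {v : Fin n}
    (hv : v ∈ diffVerts N (bridgePM M N)) : ∃ i, v = rep M N i ∨ v = pmPartner N (rep M N i) := by
  rw [mem_diffVerts, pmPartner_bridgePM] at hv
  by_contra hno
  push Not at hno
  exact hv (bridgeFun_of_not_special M N (fun i => (hno i).2) (fun i => (hno i).1)).symm

/-! ### §4 Closure lemmas: `M'` is adjacent to `M` and to `N` -/

/-- In a set closed under `M` and `M'`, the alternating `M/N`-walk from a representative `v_i ∈ T`
stays in `T` (the only `N`-steps it takes at special vertices start at `N(v_i)` and return to `v_i`).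
[cite: Schrijver2003, Vol. A §25.5a (p. 444)] -/
theorem alt_rep_mem_of_closed {M N : PMatch n} {T : Finset (Fin n)}
    (hT : IsSwitchClosed M (bridgePM M N) T) {i : Fin (numCycles M N)} (hi : rep M N i ∈ T) :
    ∀ k, alt M N (rep M N i) k ∈ T := by
  intro k
  induction k with
  | zero => exact hi
  | succ k ih =>
    rw [alt_succ]
    split_ifs with hk
    · exact (hT _ ih).1
    · -- an `N`-step: at a non-special vertex it is an `M'`-step; at `N(v_i)` it returns to `v_i`;
      -- it never starts at `v_i` (parity) nor at another circuit's special vertex (reachability)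
      set w := alt M N (rep M N i) k with hw
      by_cases h1 : ∃ j, w = pmPartner N (rep M N j)
      · obtain ⟨j, hj⟩ := h1
        have hreach : (symmDiffGraph M N).Reachable (rep M N i) (rep M N j) := by
          refine (reachable_alt (rep_mem M N i) k).trans ?_
          rw [← hw, hj]
          exact (symmDiffGraph_adj.2 ⟨pmPartner_mem_diffVerts' (rep_mem M N j),
            Or.inr (pmPartner_pmPartner N _).symm⟩).reachable
        have hij := eq_of_reachable_rep hreach
        subst hij
        rw [hj, pmPartner_pmPartner]; exact hi
      by_cases h2 : ∃ j, w = rep M N j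
      · obtain ⟨j, hj⟩ := h2
        have hreach : (symmDiffGraph M N).Reachable (rep M N i) (rep M N j) := by
          rw [← hj, hw]; exact reachable_alt (rep_mem M N i) k
        have hij := eq_of_reachable_rep hreach
        subst hij
        -- `alt k = v_i = alt 0` forces `k` even, contradicting the `N`-step
        have := mod_two_eq_of_alt_eq M N (rep M N i) (show alt M N (rep M N i) k = alt M N (rep M N i) 0 by
          rw [alt_zero]; exact hw ▸ hj)
        omega
      · push Not at h1 h2
        have := (hT _ ih).2
        rwa [pmPartner_bridgePM, bridgeFun_of_not_special M N h1 h2] at this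

/-- Hence such a set contains, with a representative, its whole circuit and in particular `N(v_i)`.
[cite: Schrijver2003, Vol. A §25.5a (p. 444)] -/
theorem mem_of_closed_of_reachable_rep {M N : PMatch n} {T : Finset (Fin n)}
    (hT : IsSwitchClosed M (bridgePM M N) T) {i : Fin (numCycles M N)} (hi : rep M N i ∈ T) {w : Fin n}
    (hw : (symmDiffGraph M N).Reachable (rep M N i) w) : w ∈ T := by
  obtain ⟨k, rfl⟩ := exists_alt_eq_of_reachable hw
  exact alt_rep_mem_of_closed hT hi k

/-- … and then the next representative (across the bridge `{N(v_i), v_{i+1}}`), hence ALL representatives.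
[cite: Schrijver2003, Vol. A §25.5a (p. 444)] -/
theorem rep_mem_of_closed {M N : PMatch n} (h : 2 ≤ numCycles M N) {T : Finset (Fin n)}
    (hT : IsSwitchClosed M (bridgePM M N) T) {i : Fin (numCycles M N)} (hi : rep M N i ∈ T)
    (j : Fin (numCycles M N)) : rep M N j ∈ T := by
  have step : ∀ i', rep M N i' ∈ T → rep M N (rot M N i') ∈ T := by
    intro i' hi'
    have h1 : pmPartner N (rep M N i') ∈ T :=
      mem_of_closed_of_reachable_rep hT hi'
        (symmDiffGraph_adj.2 ⟨rep_mem M N i', Or.inr rfl⟩).reachable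
    have := (hT _ h1).2
    rwa [pmPartner_bridgePM, bridgeFun_partner_rep] at this
  obtain ⟨k, hk⟩ := exists_rot_pow_eq h i j
  rw [← hk]
  clear hk
  induction k with
  | zero => simpa using hi
  | succ k ih => rw [pow_succ', Equiv.Perm.mul_apply]; exact step _ ih

/-- A set closed under `M` and `M'` that meets `V(M △ N)` contains a special vertex: walk from the
vertex until the first special vertex (one exists on its circuit: the representative).
[cite: Schrijver2003, Vol. A §25.5a (p. 444)] -/
theorem exists_rep_mem_of_closed {M N : PMatch n} {T : Finset (Fin n)}
    (hT : IsSwitchClosed M (bridgePM M N) T) {w : Fin n} (hwT : w ∈ T) (hwD : w ∈ diffVerts M N) :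
    ∃ i, rep M N i ∈ T := by
  obtain ⟨i, hi⟩ := exists_rep_reachable hwD
  -- the walk from `w` reaches `v_i`; take the first index at which it is special
  obtain ⟨k0, hk0⟩ := exists_alt_eq_of_reachable hi.symm
  classical
  let P : ℕ → Prop := fun k => ∃ j, alt M N w k = rep M N j ∨ alt M N w k = pmPartner N (rep M N j)
  have hex : ∃ k, P k := ⟨k0, i, Or.inl hk0⟩
  let m := Nat.find hex
  have hm : P m := Nat.find_spec hex
  have hbefore : ∀ k < m, ¬P k := fun k hk => Nat.find_min hex hk
  -- all walk vertices up to index `m` lie in `T`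
  have hmem : ∀ k ≤ m, alt M N w k ∈ T := by
    intro k
    induction k with
    | zero => intro _; exact hwT
    | succ k ih =>
      intro hk
      have hkT := ih (by omega)
      rw [alt_succ]
      split_ifs with hk2
      · exact (hT _ hkT).1
      · have hnP := hbefore k (by omega)
        have h1 : ∀ j, alt M N w k ≠ pmPartner N (rep M N j) := fun j hj => hnP ⟨j, Or.inr hj⟩
        have h2 : ∀ j, alt M N w k ≠ rep M N j := fun j hj => hnP ⟨j, Or.inl hj⟩
        have := (hT _ hkT).2
        rwa [pmPartner_bridgePM, bridgeFun_of_not_special M N h1 h2] at this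
  obtain ⟨j, hj | hj⟩ := hm
  · exact ⟨j, hj ▸ hmem m le_rfl⟩
  · -- the special vertex is `N(v_j)`: its `M'`-partner `v_{j+1}` is a representative in `T`
    refine ⟨rot M N j, ?_⟩
    have := (hT _ (hmem m le_rfl)).2
    rwa [hj, pmPartner_bridgePM, bridgeFun_partner_rep] at this

/-- **`M'` is adjacent to `M`** (switching form): no set closed under `M` and `M'` splits `V(M △ M')`.
[cite: Schrijver2003, Vol. A §25.5a (p. 444)] -/
theorem switchIrreducible_bridgePM_left {M N : PMatch n} (h : 2 ≤ numCycles M N) :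
    SwitchIrreducible M (bridgePM M N) := by
  refine ⟨?_, fun T hT => ?_⟩
  · -- `M ≠ M'`: `M'(N(v_0)) = v_1` lies on another circuit than `M(N(v_0))`
    intro heq
    have i0 : Fin (numCycles M N) := ⟨0, by omega⟩
    have h1 := congrFun (congrArg pmPartner heq) (pmPartner N (rep M N i0))
    rw [pmPartner_bridgePM, bridgeFun_partner_rep] at h1
    have hreach : (symmDiffGraph M N).Reachable (rep M N i0) (rep M N (rot M N i0)) := by
      rw [← h1]
      exact (symmDiffGraph_adj.2 ⟨rep_mem M N i0, Or.inr rfl⟩).reachable.trans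
        (symmDiffGraph_adj.2 ⟨pmPartner_mem_diffVerts' (rep_mem M N i0), Or.inl rfl⟩).reachable
    exact rot_ne_self h i0 (eq_of_reachable_rep hreach).symm
  · by_cases hdis : Disjoint (diffVerts M (bridgePM M N)) T
    · exact Or.inr hdis
    · left
      obtain ⟨w, hwD', hwT⟩ := Finset.not_disjoint_iff.1 hdis
      obtain ⟨i, hi⟩ := exists_rep_mem_of_closed hT hwT (diffVerts_bridgePM_left_subset M N hwD')
      intro v hv
      obtain ⟨j, hj⟩ := exists_rep_reachable (diffVerts_bridgePM_left_subset M N hv)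
      exact mem_of_closed_of_reachable_rep hT (rep_mem_of_closed h hT hi j) hj

/-- **`M'` is adjacent to `N`** (switching form): a set closed under `N` and `M'` containing one special
vertex contains `N(v_i)`, then `v_{i+1}` across the bridge, hence all of them.
[cite: Schrijver2003, Vol. A §25.5a (p. 444)] -/
theorem switchIrreducible_bridgePM_right {M N : PMatch n} (h : 2 ≤ numCycles M N) :
    SwitchIrreducible N (bridgePM M N) := by
  have key : ∀ T, IsSwitchClosed N (bridgePM M N) T → ∀ i, rep M N i ∈ T →
      ∀ j, rep M N j ∈ T ∧ pmPartner N (rep M N j) ∈ T := by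
    intro T hT i hi
    have step : ∀ i', rep M N i' ∈ T → rep M N (rot M N i') ∈ T := by
      intro i' hi'
      have := (hT _ (hT _ hi').1).2
      rwa [pmPartner_bridgePM, bridgeFun_partner_rep] at this
    have hall : ∀ j, rep M N j ∈ T := by
      intro j
      obtain ⟨k, hk⟩ := exists_rot_pow_eq h i j
      rw [← hk]
      clear hk
      induction k with
      | zero => simpa using hi
      | succ k ih => rw [pow_succ', Equiv.Perm.mul_apply]; exact step _ ih
    exact fun j => ⟨hall j, (hT _ (hall j)).1⟩
  refine ⟨?_, fun T hT => ?_⟩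
  · intro heq
    have i0 : Fin (numCycles M N) := ⟨0, by omega⟩
    have h1 := congrFun (congrArg pmPartner heq) (rep M N i0)
    rw [pmPartner_bridgePM, bridgeFun_rep] at h1
    have h2 := congrArg (pmPartner N) h1
    rw [pmPartner_pmPartner, pmPartner_pmPartner] at h2
    exact rot_symm_ne_self h i0 (rep_injective M N h2).symm
  · by_cases hdis : Disjoint (diffVerts N (bridgePM M N)) T
    · exact Or.inr hdis
    · left
      obtain ⟨w, hwD', hwT⟩ := Finset.not_disjoint_iff.1 hdis
      obtain ⟨i, hi⟩ := special_of_mem_diffVerts_bridgePM_right hwD'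
      have hrep : rep M N i ∈ T := by
        rcases hi with rfl | rfl
        · exact hwT
        · have := (hT _ hwT).1; rwa [pmPartner_pmPartner] at this
      intro v hv
      obtain ⟨j, hj⟩ := special_of_mem_diffVerts_bridgePM_right hv
      rcases hj with rfl | rfl
      · exact (key T hT i hrep j).1
      · exact (key T hT i hrep j).2

/-! ### §5 The diameter of `P_PM(K_n)` is at most two -/

/-- The neighbour relation is symmetric. [cite: Chvatal1975, §6 (p. 149)] -/
theorem IsNeighbor.symm {M M' : PMatch n} (h : IsNeighbor M M') : IsNeighbor M' M := by
  obtain ⟨hne, c, hcM', hc⟩ := h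
  refine ⟨hne.symm, c, hcM'.symm, fun N => ⟨by rw [hcM']; exact (hc N).1, fun hN => ?_⟩⟩
  rw [hcM'] at hN
  exact ((hc N).2 hN).symm

/-- **Common neighbour.** Two distinct perfect matchings of `K_n` whose symmetric difference is not a
single circuit have a common neighbour on `P_PM(K_n)` — the bridge matching.
[cite: Schrijver2003, Vol. A §25.5a (p. 444)] -/
theorem exists_common_neighbor {M N : PMatch n} (hne : M ≠ N) (h : ¬SymmDiffConnected M N) :
    ∃ P : PMatch n, IsNeighbor M P ∧ IsNeighbor N P := by
  have h2 := two_le_numCycles hne h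
  exact ⟨bridgePM M N, (switchIrreducible_bridgePM_left h2).isNeighbor,
    (switchIrreducible_bridgePM_right h2).isNeighbor⟩

/-- **The perfect matching polytope of `K_n` has diameter at most `2`**: any two perfect matchings are
equal, adjacent (Chvátal's neighbours: one alternating circuit), or have a common neighbour.
[cite: Schrijver2003, Vol. A §25.5a (p. 444)] -/
theorem pmPolytope_diameter_le_two (M N : PMatch n) :
    M = N ∨ IsNeighbor M N ∨ ∃ P : PMatch n, IsNeighbor M P ∧ IsNeighbor N P := by
  by_cases hne : M = N
  · exact Or.inl hne
  by_cases hc : SymmDiffConnected M N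
  · exact Or.inr (Or.inl (Chvatal1975_cor63_perfectMatching.2 hc))
  · exact Or.inr (Or.inr (exists_common_neighbor hne hc))

/-- The same in the 1-skeleton currency of Mathlib's `IsExposed`: between any two distinct vertices
`χ^M, χ^N` of `conv{χ^P}` there is an edge, or a path of two edges.
[cite: Schrijver2003, Vol. A §25.5a (p. 444)] -/
theorem pmPolytope_diameter_le_two_isExposed (M N : PMatch n) (hne : M ≠ N) :
    IsExposed ℝ (convexHull ℝ (Set.range (pmVec n))) (segment ℝ (pmVec n M) (pmVec n N)) ∨
      ∃ P : PMatch n, P ≠ M ∧ P ≠ N ∧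
        IsExposed ℝ (convexHull ℝ (Set.range (pmVec n))) (segment ℝ (pmVec n M) (pmVec n P)) ∧
        IsExposed ℝ (convexHull ℝ (Set.range (pmVec n))) (segment ℝ (pmVec n N) (pmVec n P)) := by
  rcases pmPolytope_diameter_le_two M N with h | h | ⟨P, hM, hN⟩
  · exact absurd h hne
  · exact Or.inl h.isExposed_segment
  · exact Or.inr ⟨P, hM.1.symm, hN.1.symm, hM.isExposed_segment, hN.isExposed_segment⟩

/-! ### §6 Small cases: for `n < 8` the 1-skeleton is complete -/

/-- Every circuit of `M △ N` has at least four vertices: `v, M(v), N(v), M(N(v))` are distinct.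
[cite: Schrijver2003, Vol. A §25.5a (p. 444)] -/
theorem exists_four_reachable {M N : PMatch n} {v : Fin n} (hv : v ∈ diffVerts M N) :
    ∃ S : Finset (Fin n), S.card = 4 ∧ ∀ w ∈ S, (symmDiffGraph M N).Reachable v w := by
  have hτ : pmPartner N v ∈ diffVerts M N := pmPartner_mem_diffVerts' hv
  have r1 : (symmDiffGraph M N).Reachable v (pmPartner M v) := (symmDiffGraph_adj.2 ⟨hv, Or.inl rfl⟩).reachable
  have r2 : (symmDiffGraph M N).Reachable v (pmPartner N v) := (symmDiffGraph_adj.2 ⟨hv, Or.inr rfl⟩).reachable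
  have r3 : (symmDiffGraph M N).Reachable v (pmPartner M (pmPartner N v)) :=
    r2.trans (symmDiffGraph_adj.2 ⟨hτ, Or.inl rfl⟩).reachable
  have hne : pmPartner M v ≠ pmPartner N v := mem_diffVerts.1 hv
  have a1 : v ≠ pmPartner M v := (pmPartner_ne M v).symm
  have a2 : v ≠ pmPartner N v := (pmPartner_ne N v).symm
  have a3 : v ≠ pmPartner M (pmPartner N v) := by
    intro h'; apply hne
    have := congrArg (pmPartner M) h'; rw [pmPartner_pmPartner] at this; exact this
  have a4 : pmPartner M v ≠ pmPartner M (pmPartner N v) := by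
    intro h'; apply a2
    have := congrArg (pmPartner M) h'
    rwa [pmPartner_pmPartner, pmPartner_pmPartner] at this
  have a5 : pmPartner N v ≠ pmPartner M (pmPartner N v) := (pmPartner_ne M _).symm
  have m1 : v ∉ ({pmPartner M v, pmPartner N v, pmPartner M (pmPartner N v)} : Finset (Fin n)) := by
    simp only [mem_insert, mem_singleton, not_or]; exact ⟨a1, a2, a3⟩
  have m2 : pmPartner M v ∉ ({pmPartner N v, pmPartner M (pmPartner N v)} : Finset (Fin n)) := by
    simp only [mem_insert, mem_singleton, not_or]; exact ⟨hne, a4⟩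
  have m3 : pmPartner N v ∉ ({pmPartner M (pmPartner N v)} : Finset (Fin n)) := by
    simp only [mem_singleton]; exact a5
  refine ⟨{v, pmPartner M v, pmPartner N v, pmPartner M (pmPartner N v)}, ?_, ?_⟩
  · rw [card_insert_of_notMem m1, card_insert_of_notMem m2, card_insert_of_notMem m3, card_singleton]
  · intro w hw
    simp only [mem_insert, mem_singleton] at hw
    rcases hw with rfl | rfl | rfl | rfl
    · exact SimpleGraph.Reachable.refl _
    · exact r1
    · exact r2
    · exact r3

/-- Two circuits need eight vertices: if `M △ N` is not connected then `8 ≤ n`.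
[cite: Schrijver2003, Vol. A §25.5a (p. 444)] -/
theorem eight_le_of_not_symmDiffConnected {M N : PMatch n} (hne : M ≠ N) (h : ¬SymmDiffConnected M N) :
    8 ≤ n := by
  unfold SymmDiffConnected at h
  push Not at h
  obtain ⟨u, hu, v, hv, huv⟩ := h hne
  rw [support_symmDiffGraph, Finset.mem_coe] at hu hv
  obtain ⟨A, hA, hAr⟩ := exists_four_reachable hu
  obtain ⟨B, hB, hBr⟩ := exists_four_reachable hv
  have hAB : Disjoint A B := by
    rw [Finset.disjoint_left]
    intro w hwA hwB
    exact huv ((hAr w hwA).trans (hBr w hwB).symm)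
  have h8 : (A ∪ B).card = 8 := by rw [card_union_of_disjoint hAB, hA, hB]
  have hle : (A ∪ B).card ≤ n := by
    calc (A ∪ B).card ≤ (Finset.univ : Finset (Fin n)).card := card_le_card (subset_univ _)
      _ = n := by rw [card_univ, Fintype.card_fin]
  omega

/-- **For `n < 8` any two distinct perfect matchings of `K_n` are adjacent** (the 1-skeletons of
`P_PM(K_4)` — a triangle — and of `P_PM(K_6)` — `K_15` — are complete graphs).
[cite: Schrijver2003, Vol. A §25.5a (p. 444)] -/
theorem isNeighbor_of_lt_eight (hn : n < 8) {M N : PMatch n} (hne : M ≠ N) : IsNeighbor M N := by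
  by_contra h
  rw [Chvatal1975_cor63_perfectMatching] at h
  exact absurd (eight_le_of_not_symmDiffConnected hne h) (by omega)

/-! ### §7 For `n ≥ 8` the diameter is exactly two: a non-adjacent pair -/

/-- The double transposition `(a₁ a₂)(a₃ a₄)` as a function. [cite: Schrijver2003, Vol. A §25.5a (p. 444)] -/
def dswap (a₁ a₂ a₃ a₄ : Fin n) : Fin n → Fin n := fun v =>
  if v = a₁ ∨ v = a₂ then Equiv.swap a₁ a₂ v else Equiv.swap a₃ a₄ v

/-- The conjugate `π ∘ M ∘ π` of the partner map of `M` by the double transposition `π = (a₁ a₂)(a₃ a₄)`: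
it replaces the `M`-edges `{a₁, M(a₁)}, {a₂, M(a₂)}` by `{a₁, M(a₂)}, {a₂, M(a₁)}` and likewise for
`a₃, a₄` — two disjoint alternating 4-cycles. [cite: Schrijver2003, Vol. A §25.5a (p. 444)] -/
def twoSquaresFun (M : PMatch n) (a₁ a₂ a₃ a₄ : Fin n) : Fin n → Fin n :=
  fun v => dswap a₁ a₂ a₃ a₄ (pmPartner M (dswap a₁ a₂ a₃ a₄ v))

/-- `π` is an involution when `{a₁, a₂}` and `{a₃, a₄}` are disjoint. [cite: Schrijver2003, Vol. A §25.5a (p. 444)] -/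
theorem dswap_dswap {a₁ a₂ a₃ a₄ : Fin n} (h13 : a₁ ≠ a₃) (h14 : a₁ ≠ a₄) (h23 : a₂ ≠ a₃) (h24 : a₂ ≠ a₄)
    (v : Fin n) : dswap a₁ a₂ a₃ a₄ (dswap a₁ a₂ a₃ a₄ v) = v := by
  unfold dswap
  by_cases h12 : v = a₁ ∨ v = a₂
  · have hin : Equiv.swap a₁ a₂ v = a₁ ∨ Equiv.swap a₁ a₂ v = a₂ := by
      rcases h12 with rfl | rfl
      · exact Or.inr (Equiv.swap_apply_left _ _)
      · exact Or.inl (Equiv.swap_apply_right _ _)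
    rw [if_pos h12, if_pos hin, Equiv.swap_apply_self]
  · have hout : ¬(Equiv.swap a₃ a₄ v = a₁ ∨ Equiv.swap a₃ a₄ v = a₂) := by
      push Not at h12 ⊢
      by_cases h3 : v = a₃
      · subst h3; rw [Equiv.swap_apply_left]; exact ⟨h14.symm, h24.symm⟩
      by_cases h4 : v = a₄
      · subst h4; rw [Equiv.swap_apply_right]; exact ⟨h13.symm, h23.symm⟩
      · rw [Equiv.swap_apply_of_ne_of_ne h3 h4]; exact h12
    rw [if_neg h12, if_neg hout, Equiv.swap_apply_self]

/-- The conjugate map is a fixed-point-free involution. [cite: Schrijver2003, Vol. A §25.5a (p. 444)] -/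
theorem isPM_twoSquaresFun (M : PMatch n) {a₁ a₂ a₃ a₄ : Fin n} (h13 : a₁ ≠ a₃) (h14 : a₁ ≠ a₄)
    (h23 : a₂ ≠ a₃) (h24 : a₂ ≠ a₄) : IsPM (twoSquaresFun M a₁ a₂ a₃ a₄) := by
  intro v
  unfold twoSquaresFun
  refine ⟨fun h => ?_, ?_⟩
  · -- a fixed point of the conjugate is a fixed point of `M` at `π v`
    have := congrArg (dswap a₁ a₂ a₃ a₄) h
    rw [dswap_dswap h13 h14 h23 h24] at this
    exact pmPartner_ne M _ this
  · rw [dswap_dswap h13 h14 h23 h24, pmPartner_pmPartner, dswap_dswap h13 h14 h23 h24]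

/-- The perfect matching `N = π M π`. [cite: Schrijver2003, Vol. A §25.5a (p. 444)] -/
def twoSquaresPM (M : PMatch n) {a₁ a₂ a₃ a₄ : Fin n} (h13 : a₁ ≠ a₃) (h14 : a₁ ≠ a₄) (h23 : a₂ ≠ a₃)
    (h24 : a₂ ≠ a₄) : PMatch n :=
  pmOfFun (twoSquaresFun M a₁ a₂ a₃ a₄) (isPM_twoSquaresFun M h13 h14 h23 h24)

/-- **A non-adjacent pair.** If `a₁, a₂, a₃, a₄` and their `M`-partners are eight distinct vertices then
`N = π M π` is not a neighbour of `M`: the `M`- and `N`-closed set `{a₁, M(a₁), a₂, M(a₂)}` splits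
`V(M △ N)` (it misses `a₃`), i.e. `M △ N` is two circuits. [cite: Schrijver2003, Vol. A §25.5a (p. 444)] -/
theorem not_isNeighbor_twoSquaresPM (M : PMatch n) {a₁ a₂ a₃ a₄ : Fin n} (h12 : a₁ ≠ a₂) (h13 : a₁ ≠ a₃)
    (h14 : a₁ ≠ a₄) (h23 : a₂ ≠ a₃) (h24 : a₂ ≠ a₄) (h34 : a₃ ≠ a₄)
    (hσ : ∀ i ∈ ({a₁, a₂, a₃, a₄} : Finset (Fin n)), ∀ j ∈ ({a₁, a₂, a₃, a₄} : Finset (Fin n)),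
      pmPartner M i ≠ j) :
    twoSquaresPM M h13 h14 h23 h24 ≠ M ∧ ¬IsNeighbor M (twoSquaresPM M h13 h14 h23 h24) := by
  set N := twoSquaresPM M h13 h14 h23 h24 with hN
  have hνdef : pmPartner N = twoSquaresFun M a₁ a₂ a₃ a₄ := pmPartner_pmOfFun _
  have mem4 : ∀ x, x ∈ ({a₁, a₂, a₃, a₄} : Finset (Fin n)) ↔ x = a₁ ∨ x = a₂ ∨ x = a₃ ∨ x = a₄ := by
    intro x; simp only [mem_insert, mem_singleton]
  have hσ' : ∀ i, (i = a₁ ∨ i = a₂ ∨ i = a₃ ∨ i = a₄) → ∀ j, (j = a₁ ∨ j = a₂ ∨ j = a₃ ∨ j = a₄) →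
      pmPartner M i ≠ j := fun i hi j hj => hσ i ((mem4 i).2 hi) j ((mem4 j).2 hj)
  -- values of `π`
  have π1 : dswap a₁ a₂ a₃ a₄ a₁ = a₂ := by
    unfold dswap; rw [if_pos (Or.inl rfl), Equiv.swap_apply_left]
  have π2 : dswap a₁ a₂ a₃ a₄ a₂ = a₁ := by
    unfold dswap; rw [if_pos (Or.inr rfl), Equiv.swap_apply_right]
  have π3 : dswap a₁ a₂ a₃ a₄ a₃ = a₄ := by
    unfold dswap; rw [if_neg (by push Not; exact ⟨h13.symm, h23.symm⟩), Equiv.swap_apply_left]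
  have πfix : ∀ v, v ≠ a₁ → v ≠ a₂ → v ≠ a₃ → v ≠ a₄ → dswap a₁ a₂ a₃ a₄ v = v := by
    intro v h1 h2 h3 h4
    unfold dswap; rw [if_neg (by push Not; exact ⟨h1, h2⟩), Equiv.swap_apply_of_ne_of_ne h3 h4]
  have πσ : ∀ i, (i = a₁ ∨ i = a₂ ∨ i = a₃ ∨ i = a₄) → dswap a₁ a₂ a₃ a₄ (pmPartner M i) = pmPartner M i :=
    fun i hi => πfix _ (hσ' i hi _ (Or.inl rfl)) (hσ' i hi _ (Or.inr (Or.inl rfl)))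
      (hσ' i hi _ (Or.inr (Or.inr (Or.inl rfl)))) (hσ' i hi _ (Or.inr (Or.inr (Or.inr rfl))))
  -- values of `N`
  have ν1 : pmPartner N a₁ = pmPartner M a₂ := by
    rw [hνdef]; unfold twoSquaresFun; rw [π1, πσ a₂ (Or.inr (Or.inl rfl))]
  have ν2 : pmPartner N a₂ = pmPartner M a₁ := by
    rw [hνdef]; unfold twoSquaresFun; rw [π2, πσ a₁ (Or.inl rfl)]
  have ν3 : pmPartner N a₃ = pmPartner M a₄ := by
    rw [hνdef]; unfold twoSquaresFun; rw [π3, πσ a₄ (Or.inr (Or.inr (Or.inr rfl)))]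
  have νσ1 : pmPartner N (pmPartner M a₁) = a₂ := by
    rw [hνdef]; unfold twoSquaresFun; rw [πσ a₁ (Or.inl rfl), pmPartner_pmPartner, π1]
  have νσ2 : pmPartner N (pmPartner M a₂) = a₁ := by
    rw [hνdef]; unfold twoSquaresFun; rw [πσ a₂ (Or.inr (Or.inl rfl)), pmPartner_pmPartner, π2]
  -- `a₁, a₃ ∈ V(M △ N)`
  have ha1 : a₁ ∈ diffVerts M N := by
    rw [mem_diffVerts, ν1]
    intro h; apply h12
    have := congrArg (pmPartner M) h; rwa [pmPartner_pmPartner, pmPartner_pmPartner] at this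
  have ha3 : a₃ ∈ diffVerts M N := by
    rw [mem_diffVerts, ν3]
    intro h; apply h34
    have := congrArg (pmPartner M) h; rwa [pmPartner_pmPartner, pmPartner_pmPartner] at this
  have hne : N ≠ M := fun h => by rw [h, diffVerts_eq_empty_iff.2 rfl] at ha1; exact notMem_empty _ ha1
  refine ⟨hne, fun hnb => ?_⟩
  obtain ⟨-, hirr⟩ := hnb.switchIrreducible
  -- the closed set `{a₁, M a₁, a₂, M a₂}`
  let T : Finset (Fin n) := {a₁, pmPartner M a₁, a₂, pmPartner M a₂}
  have memT : ∀ x, x ∈ T ↔ x = a₁ ∨ x = pmPartner M a₁ ∨ x = a₂ ∨ x = pmPartner M a₂ := by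
    intro x; simp only [T, mem_insert, mem_singleton]
  have hT : IsSwitchClosed M N T := by
    intro v hv
    rw [memT] at hv
    rw [memT, memT]
    rcases hv with rfl | rfl | rfl | rfl
    · exact ⟨Or.inr (Or.inl rfl), by rw [ν1]; exact Or.inr (Or.inr (Or.inr rfl))⟩
    · exact ⟨by rw [pmPartner_pmPartner]; exact Or.inl rfl, by rw [νσ1]; exact Or.inr (Or.inr (Or.inl rfl))⟩
    · exact ⟨Or.inr (Or.inr (Or.inr rfl)), by rw [ν2]; exact Or.inr (Or.inl rfl)⟩
    · exact ⟨by rw [pmPartner_pmPartner]; exact Or.inr (Or.inr (Or.inl rfl)), by rw [νσ2]; exact Or.inl rfl⟩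
  rcases hirr T hT with hsub | hdis
  · have := (memT a₃).1 (hsub ha3)
    rcases this with h | h | h | h
    · exact h13 h.symm
    · exact hσ' a₁ (Or.inl rfl) a₃ (Or.inr (Or.inr (Or.inl rfl))) h.symm
    · exact h23 h.symm
    · exact hσ' a₂ (Or.inr (Or.inl rfl)) a₃ (Or.inr (Or.inr (Or.inl rfl))) h.symm
  · exact Finset.disjoint_left.1 hdis ha1 ((memT a₁).2 (Or.inl rfl))

/-- Four vertices of `K_n`, `n ≥ 8`, pairwise distinct together with their `M`-partners.
[cite: Schrijver2003, Vol. A §25.5a (p. 444)] -/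
theorem exists_four_spread (hn : 8 ≤ n) (M : PMatch n) :
    ∃ a₁ a₂ a₃ a₄ : Fin n, a₁ ≠ a₂ ∧ a₁ ≠ a₃ ∧ a₁ ≠ a₄ ∧ a₂ ≠ a₃ ∧ a₂ ≠ a₄ ∧ a₃ ≠ a₄ ∧
      ∀ i ∈ ({a₁, a₂, a₃, a₄} : Finset (Fin n)), ∀ j ∈ ({a₁, a₂, a₃, a₄} : Finset (Fin n)),
        pmPartner M i ≠ j := by
  classical
  -- greedy choice: avoid the previously chosen vertices and their partners
  have pick : ∀ S : Finset (Fin n), S.card ≤ 6 → ∃ a, a ∉ S := by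
    intro S hS
    have : S.card < (Finset.univ : Finset (Fin n)).card := by rw [card_univ, Fintype.card_fin]; omega
    obtain ⟨a, -, ha⟩ := exists_mem_notMem_of_card_lt_card this
    exact ⟨a, ha⟩
  have cl : ∀ (S : Finset (Fin n)), (∀ x ∈ S, pmPartner M x ∈ S) → ∀ a, a ∉ S →
      ∀ x ∈ S, a ≠ x ∧ pmPartner M a ≠ x ∧ pmPartner M x ≠ a := by
    intro S hS a ha x hx
    refine ⟨?_, ?_, ?_⟩
    · rintro rfl; exact ha hx
    · intro h
      apply ha
      have h' := hS x hx
      rw [← h, pmPartner_pmPartner] at h'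
      exact h'
    · intro h; apply ha; rw [← h]; exact hS x hx
  obtain ⟨a₁, -⟩ := pick ∅ (by simp)
  let S₁ : Finset (Fin n) := {a₁, pmPartner M a₁}
  have hS₁ : ∀ x ∈ S₁, pmPartner M x ∈ S₁ := by
    intro x hx; simp only [S₁, mem_insert, mem_singleton] at hx ⊢
    rcases hx with rfl | rfl
    · exact Or.inr rfl
    · exact Or.inl (pmPartner_pmPartner M _)
  obtain ⟨a₂, ha₂⟩ := pick S₁ (by
    have h1 := card_insert_le a₁ ({pmPartner M a₁} : Finset (Fin n))
    have h2 : ({pmPartner M a₁} : Finset (Fin n)).card = 1 := card_singleton _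
    show S₁.card ≤ 6
    simp only [S₁]; omega)
  have c2 := cl S₁ hS₁ a₂ ha₂
  let S₂ : Finset (Fin n) := {a₁, pmPartner M a₁, a₂, pmPartner M a₂}
  have hS₂ : ∀ x ∈ S₂, pmPartner M x ∈ S₂ := by
    intro x hx; simp only [S₂, mem_insert, mem_singleton] at hx ⊢
    rcases hx with rfl | rfl | rfl | rfl
    · exact Or.inr (Or.inl rfl)
    · exact Or.inl (pmPartner_pmPartner M _)
    · exact Or.inr (Or.inr (Or.inr rfl))
    · exact Or.inr (Or.inr (Or.inl (pmPartner_pmPartner M _)))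
  obtain ⟨a₃, ha₃⟩ := pick S₂ (by
    have h1 := card_insert_le a₁ ({pmPartner M a₁, a₂, pmPartner M a₂} : Finset (Fin n))
    have h2 := card_insert_le (pmPartner M a₁) ({a₂, pmPartner M a₂} : Finset (Fin n))
    have h3 := card_insert_le a₂ ({pmPartner M a₂} : Finset (Fin n))
    have h4 : ({pmPartner M a₂} : Finset (Fin n)).card = 1 := card_singleton _
    show S₂.card ≤ 6
    simp only [S₂]; omega)
  have c3 := cl S₂ hS₂ a₃ ha₃
  let S₃ : Finset (Fin n) := {a₁, pmPartner M a₁, a₂, pmPartner M a₂, a₃, pmPartner M a₃}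
  have hS₃ : ∀ x ∈ S₃, pmPartner M x ∈ S₃ := by
    intro x hx; simp only [S₃, mem_insert, mem_singleton] at hx ⊢
    rcases hx with rfl | rfl | rfl | rfl | rfl | rfl
    · exact Or.inr (Or.inl rfl)
    · exact Or.inl (pmPartner_pmPartner M _)
    · exact Or.inr (Or.inr (Or.inr (Or.inl rfl)))
    · exact Or.inr (Or.inr (Or.inl (pmPartner_pmPartner M _)))
    · exact Or.inr (Or.inr (Or.inr (Or.inr (Or.inr rfl))))
    · exact Or.inr (Or.inr (Or.inr (Or.inr (Or.inl (pmPartner_pmPartner M _)))))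
  obtain ⟨a₄, ha₄⟩ := pick S₃ (by
    have h1 := card_insert_le a₁ ({pmPartner M a₁, a₂, pmPartner M a₂, a₃, pmPartner M a₃} : Finset (Fin n))
    have h2 := card_insert_le (pmPartner M a₁) ({a₂, pmPartner M a₂, a₃, pmPartner M a₃} : Finset (Fin n))
    have h3 := card_insert_le a₂ ({pmPartner M a₂, a₃, pmPartner M a₃} : Finset (Fin n))
    have h4 := card_insert_le (pmPartner M a₂) ({a₃, pmPartner M a₃} : Finset (Fin n))
    have h5 := card_insert_le a₃ ({pmPartner M a₃} : Finset (Fin n))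
    have h6 : ({pmPartner M a₃} : Finset (Fin n)).card = 1 := card_singleton _
    show S₃.card ≤ 6
    simp only [S₃]; omega)
  have c4 := cl S₃ hS₃ a₄ ha₄
  have m1S₁ : a₁ ∈ S₁ := by simp [S₁]
  have m1S₂ : a₁ ∈ S₂ := by simp [S₂]
  have m2S₂ : a₂ ∈ S₂ := by simp [S₂]
  have m1S₃ : a₁ ∈ S₃ := by simp [S₃]
  have m2S₃ : a₂ ∈ S₃ := by simp [S₃]
  have m3S₃ : a₃ ∈ S₃ := by simp [S₃]
  refine ⟨a₁, a₂, a₃, a₄, (c2 a₁ m1S₁).1.symm, (c3 a₁ m1S₂).1.symm, (c4 a₁ m1S₃).1.symm,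
    (c3 a₂ m2S₂).1.symm, (c4 a₂ m2S₃).1.symm, (c4 a₃ m3S₃).1.symm, ?_⟩
  intro i hi j hj
  simp only [mem_insert, mem_singleton] at hi hj
  rcases hi with rfl | rfl | rfl | rfl <;> rcases hj with rfl | rfl | rfl | rfl
  · exact pmPartner_ne M _
  · exact (c2 _ m1S₁).2.2
  · exact (c3 _ m1S₂).2.2
  · exact (c4 _ m1S₃).2.2
  · exact (c2 _ m1S₁).2.1
  · exact pmPartner_ne M _
  · exact (c3 _ m2S₂).2.2
  · exact (c4 _ m2S₃).2.2
  · exact (c3 _ m1S₂).2.1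
  · exact (c3 _ m2S₂).2.1
  · exact pmPartner_ne M _
  · exact (c4 _ m3S₃).2.2
  · exact (c4 _ m1S₃).2.1
  · exact (c4 _ m2S₃).2.1
  · exact (c4 _ m3S₃).2.1
  · exact pmPartner_ne M _

/-- **For `n ≥ 8` every vertex of `P_PM(K_n)` has a non-neighbour** — so (with
`pmPolytope_diameter_le_two`) the diameter of `P_PM(K_n)` is exactly `2` for even `n ≥ 8`
(and `1` for `n = 4, 6` by `isNeighbor_of_lt_eight`). [cite: Schrijver2003, Vol. A §25.5a (p. 444)] -/
theorem exists_not_isNeighbor (hn : 8 ≤ n) (M : PMatch n) : ∃ N : PMatch n, N ≠ M ∧ ¬IsNeighbor M N := by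
  obtain ⟨a₁, a₂, a₃, a₄, h12, h13, h14, h23, h24, h34, hσ⟩ := exists_four_spread hn M
  exact ⟨_, not_isNeighbor_twoSquaresPM M h12 h13 h14 h23 h24 h34 hσ⟩

/-- **Diameter exactly two (`n ≥ 8`)**: there are perfect matchings `M ≠ N` of `K_n` that are NOT
adjacent, and any such pair has a common neighbour. [cite: Schrijver2003, Vol. A §25.5a (p. 444)] -/
theorem pmPolytope_diameter_eq_two (hn : 8 ≤ n) (M : PMatch n) :
    ∃ N : PMatch n, N ≠ M ∧ ¬IsNeighbor M N ∧ ∃ P : PMatch n, IsNeighbor M P ∧ IsNeighbor N P := by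
  obtain ⟨N, hNM, hnot⟩ := exists_not_isNeighbor hn M
  rcases pmPolytope_diameter_le_two M N with h | h | h
  · exact absurd h.symm hNM
  · exact absurd h hnot
  · exact ⟨N, hNM, hnot, h⟩

end PMPolytopeDim

end Literature.Combinatorics.Optimization
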